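import Summits.RiemannHypothesis.RiemannHypothesis.Theorems.Splittings.ScrewKreinCoreDefs
import HarnessLib

/-!
# Screw index transfer via Kreĭn definitizability — analytic core, part 2/5: (A) positivity ⟹ bounded translates

CUT 2/5 of `ScrewIndexTransferKreinCore` (rh-split-screw-bridge g5).  `pieceA_holds : PieceA`: if the
`Q(−i d/dx)`-twisted form of `f = −Ψ` is nonnegative on test functions, then the translate form
`F_φ(s) = ∬ f(x+s−y)(Qφ)(x) conj((Qφ)(y)) dx dy` is continuous with `‖F_φ(s)‖ ≤ F_φ(0)`: positivity at
`ψ = τ_sφ − λφ` (`|λ| = 1`), translation invariance (Haar), Hermitian symmetry (Fubini on the compactly supported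
product kernel; `f` real and even), `λ := F(s)/‖F(s)‖`.  Test-function bookkeeping for `applyQ` (`Q(−i d/dx)`
commutes with translations, preserves compact support).

HONEST LABEL.  `CofiniteCriticalLine` (all but finitely many nontrivial zeros on the line) is NOT RH, and
ETAIL (eventual positivity of the screw pivots) is NOT the screw criterion `∀ M, 0 < screwPivot M`; this module is
part of a chain relating the two tails to each other and decides neither.  Nothing here bears on the truth of RH.
-/

noncomputable section

set_option linter.dupNamespace false

namespace Summit.RiemannHypothesis.RiemannHypothesis.Theorems.Splittings.ScrewKreinCore

open Finset Complex MeasureTheory Set Filter Topology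
open Literature.NumberTheory.LFunctions
open Literature.Analysis.OperatorTheory
open Summit.RiemannHypothesis.RiemannHypothesis.Theses.RuelleBand
open Summit.RiemannHypothesis.RiemannHypothesis.Theorems.IntegerScrew

/-! ## Towards (A): test-function bookkeeping for `applyQ` -/

/-- The topological support of every iterated derivative of `φ` lies in that of `φ`. -/
theorem tsupport_iteratedDeriv_subset (φ : ℝ → ℂ) : ∀ j : ℕ, tsupport (iteratedDeriv j φ) ⊆ tsupport φ
  | 0 => by simp [iteratedDeriv_zero]
  | j + 1 => by
    rw [iteratedDeriv_succ]
    exact (tsupport_deriv_subset).trans (tsupport_iteratedDeriv_subset φ j)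

/-- Every iterated derivative of `φ` vanishes outside the topological support of `φ`. -/
theorem iteratedDeriv_eq_zero_of_notMem {φ : ℝ → ℂ} {x : ℝ} (hx : x ∉ tsupport φ) (j : ℕ) :
    iteratedDeriv j φ x = 0 :=
  image_eq_zero_of_notMem_tsupport fun h => hx (tsupport_iteratedDeriv_subset φ j h)

/-- `Q(−i d/dx) φ` is continuous for a test function `φ`. -/
theorem continuous_applyQ (Q : Polynomial ℂ) {φ : ℝ → ℂ} (hφ : IsTest φ) : Continuous (applyQ Q φ) := by
  unfold applyQ
  refine continuous_finsetSum _ fun j _ => continuous_const.mul ?_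
  exact hφ.1.continuous_iteratedDeriv j (by exact_mod_cast le_top)

/-- `Q(−i d/dx) φ` vanishes outside the topological support of `φ`. -/
theorem applyQ_eq_zero_of_notMem (Q : Polynomial ℂ) {φ : ℝ → ℂ} {x : ℝ} (hx : x ∉ tsupport φ) :
    applyQ Q φ x = 0 := by
  unfold applyQ
  exact sum_eq_zero fun j _ => by rw [iteratedDeriv_eq_zero_of_notMem hx j, mul_zero]

/-- `Q(−i d/dx) φ` has compact support for a test function `φ`. -/
theorem hasCompactSupport_applyQ (Q : Polynomial ℂ) {φ : ℝ → ℂ} (hφ : IsTest φ) :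
    HasCompactSupport (applyQ Q φ) :=
  HasCompactSupport.intro hφ.2 fun _ hx => applyQ_eq_zero_of_notMem Q hx

/-- `Q(−i d/dx)` commutes with translation and is linear: applied to `ψ = τ_s φ − λ φ`. -/
theorem applyQ_transl_sub (Q : Polynomial ℂ) {φ : ℝ → ℂ} (hφ : IsTest φ) (s : ℝ) (l : ℂ) (x : ℝ) :
    applyQ Q (fun y => φ (y - s) - l * φ y) x = applyQ Q φ (x - s) - l * applyQ Q φ x := by
  unfold applyQ
  rw [Finset.mul_sum, ← Finset.sum_sub_distrib]
  refine sum_congr rfl fun j _ => ?_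
  have h1 : ContDiffAt ℝ (j : ℕ∞) (fun y => φ (y - s)) x :=
    ((hφ.1.of_le (by exact_mod_cast le_top)).comp (contDiff_id.sub contDiff_const)).contDiffAt
  have h2 : ContDiffAt ℝ (j : ℕ∞) (fun y => l * φ y) x :=
    (contDiff_const.mul (hφ.1.of_le (by exact_mod_cast le_top))).contDiffAt
  have hsub : (fun y => φ (y - s) - l * φ y) = (fun y => φ (y - s)) - fun y => l * φ y := rfl
  rw [hsub, iteratedDeriv_sub h1 h2, iteratedDeriv_const_mul l
      ((hφ.1.of_le (by exact_mod_cast le_top)).contDiffAt),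
    show iteratedDeriv j (fun y => φ (y - s)) x = iteratedDeriv j φ (x - s) from
      congrFun (iteratedDeriv_comp_sub_const j φ s) x]
  ring

/-- `τ_s φ − λ φ` is a test function. -/
theorem isTest_transl_sub {φ : ℝ → ℂ} (hφ : IsTest φ) (s : ℝ) (l : ℂ) :
    IsTest fun y => φ (y - s) - l * φ y := by
  refine ⟨(hφ.1.comp (contDiff_id.sub contDiff_const)).sub (contDiff_const.mul hφ.1), ?_⟩
  obtain ⟨R, hR⟩ := hφ.2.isCompact.isBounded.subset_closedBall 0
  refine HasCompactSupport.intro (isCompact_closedBall (0 : ℝ) (R + |s|)) fun x hx => ?_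
  rw [Metric.mem_closedBall, dist_zero_right, Real.norm_eq_abs, not_le] at hx
  have h1 : x - s ∉ tsupport φ := fun h => by
    have := hR h
    rw [Metric.mem_closedBall, dist_zero_right, Real.norm_eq_abs] at this
    have : |x| ≤ |x - s| + |s| := by
      calc |x| = |x - s + s| := by rw [sub_add_cancel]
        _ ≤ |x - s| + |s| := abs_add_le _ _
    linarith
  have h2 : x ∉ tsupport φ := fun h => by
    have := hR h
    rw [Metric.mem_closedBall, dist_zero_right, Real.norm_eq_abs] at this
    linarith [abs_nonneg s]
  simp [image_eq_zero_of_notMem_tsupport h1, image_eq_zero_of_notMem_tsupport h2]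


/-! ## Towards (A): the kernel form, its translation symmetries, and the positivity bound -/

/-- `fC = −Ψ` (complex-valued) is continuous. -/
theorem continuous_fC : Continuous fC := continuous_ofReal.comp continuous_zetaScrew.neg

/-- `fC` is even. -/
@[simp] theorem fC_neg (u : ℝ) : fC (-u) = fC u := by simp [fC]

/-- `fC` is real-valued: `conj (fC u) = fC u`. -/
@[simp] theorem conj_fC (u : ℝ) : (starRingEnd ℂ) (fC u) = fC u := by
  simp [fC, Complex.conj_ofReal]

/-- `Gconv b x = ∫ fC (x − y) conj(b y) dy`. -/
def Gconv (b : ℝ → ℂ) (x : ℝ) : ℂ := ∫ y, fC (x - y) * (starRingEnd ℂ) (b y)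

/-- `Kf u v = ∬ fC (x − y) u(x) conj(v(y)) dy dx` (iterated). -/
def Kf (u v : ℝ → ℂ) : ℂ := ∫ x, ∫ y, fC (x - y) * u x * (starRingEnd ℂ) (v y)

/-- The kernel section `x ↦ ∫ f(x−y) conj(b y) dy` is continuous for continuous compactly supported `b`. -/
theorem continuous_Gconv {b : ℝ → ℂ} (hb : Continuous b) (hbs : HasCompactSupport b) :
    Continuous (Gconv b) := by
  have h : Gconv b = fun x => ∫ y in tsupport b, fC (x - y) * (starRingEnd ℂ) (b y) := by
    funext x
    rw [Gconv, setIntegral_eq_integral_of_forall_compl_eq_zero]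
    intro y hy
    simp [image_eq_zero_of_notMem_tsupport hy]
  rw [h]
  have hc : Continuous (Function.uncurry fun (x y : ℝ) => fC (x - y) * (starRingEnd ℂ) (b y)) :=
    (continuous_fC.comp (continuous_fst.sub continuous_snd)).mul
      (Complex.continuous_conj.comp (hb.comp continuous_snd))
  exact continuous_parametric_integral_of_continuous hc hbs.isCompact

/-- The inner integral of the Kreĭn form factors as `u x · Gconv v x`. -/
theorem inner_eq (u v : ℝ → ℂ) (x : ℝ) :
    (∫ y, fC (x - y) * u x * (starRingEnd ℂ) (v y)) = u x * Gconv v x := by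
  rw [Gconv, ← integral_const_mul]
  congr 1; funext y; ring

/-- The Kreĭn form as a single integral: `Kf u v = ∫ u x · Gconv v x`. -/
theorem Kf_eq (u v : ℝ → ℂ) : Kf u v = ∫ x, u x * Gconv v x := by
  unfold Kf
  exact congrArg (fun g : ℝ → ℂ => ∫ x, g x) (funext (inner_eq u v))

/-- The inner integrand of the Kreĭn form is integrable in `y` for every `x`. -/
theorem integrable_inner {u v : ℝ → ℂ} (hv : Continuous v) (hvs : HasCompactSupport v) (x : ℝ) :
    Integrable fun y => fC (x - y) * u x * (starRingEnd ℂ) (v y) := by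
  refine Continuous.integrable_of_hasCompactSupport ?_ ?_
  · exact ((continuous_fC.comp (continuous_const.sub continuous_id)).mul continuous_const).mul
      (Complex.continuous_conj.comp hv)
  · exact HasCompactSupport.intro hvs fun y hy => by simp [image_eq_zero_of_notMem_tsupport hy]

/-- The inner integral of the Kreĭn form is integrable in `x` (continuous compactly supported data). -/
theorem integrable_outer {u v : ℝ → ℂ} (hu : Continuous u) (hus : HasCompactSupport u)
    (hv : Continuous v) (hvs : HasCompactSupport v) :
    Integrable fun x => ∫ y, fC (x - y) * u x * (starRingEnd ℂ) (v y) := by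
  have h : (fun x => ∫ y, fC (x - y) * u x * (starRingEnd ℂ) (v y)) = fun x => u x * Gconv v x :=
    funext (inner_eq u v)
  rw [h]
  exact (hu.mul (continuous_Gconv hv hvs)).integrable_of_hasCompactSupport
    (HasCompactSupport.intro hus fun x hx => by simp [image_eq_zero_of_notMem_tsupport hx])

/-- Four-term linearity of the integral. -/
theorem integral_expand4 {F11 F12 F21 F22 : ℝ → ℂ} (h11 : Integrable F11) (h12 : Integrable F12)
    (h21 : Integrable F21) (h22 : Integrable F22) (l : ℂ) :
    (∫ y, (F11 y - (starRingEnd ℂ) l * F12 y - l * F21 y + l * (starRingEnd ℂ) l * F22 y)) =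
      (∫ y, F11 y) - (starRingEnd ℂ) l * (∫ y, F12 y) - l * (∫ y, F21 y)
        + l * (starRingEnd ℂ) l * ∫ y, F22 y := by
  have i12 : Integrable fun y => (starRingEnd ℂ) l * F12 y := h12.const_mul _
  have i21 : Integrable fun y => l * F21 y := h21.const_mul _
  have i22 : Integrable fun y => l * (starRingEnd ℂ) l * F22 y := h22.const_mul _
  have iA : Integrable fun y => F11 y - (starRingEnd ℂ) l * F12 y := h11.sub i12
  have iB : Integrable fun y => F11 y - (starRingEnd ℂ) l * F12 y - l * F21 y := iA.sub i21
  rw [integral_add iB i22, integral_sub iA i21, integral_sub h11 i12, integral_const_mul,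
    integral_const_mul, integral_const_mul]

/-- The translate `x ↦ (Qφ)(x − s)` has compact support. -/
theorem hasCompactSupport_applyQ_transl (Q : Polynomial ℂ) {φ : ℝ → ℂ} (hφ : IsTest φ) (s : ℝ) :
    HasCompactSupport fun x => applyQ Q φ (x - s) := by
  have h0 := hasCompactSupport_applyQ Q (isTest_transl_sub hφ s 0)
  have : (applyQ Q fun y => φ (y - s) - 0 * φ y) = fun x => applyQ Q φ (x - s) := by
    funext x; rw [applyQ_transl_sub Q hφ]; ring
  rwa [this] at h0

/-- Expansion of the form at `ψ = τ_s φ − λ φ`. -/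
theorem Kf_transl_sub (Q : Polynomial ℂ) {φ : ℝ → ℂ} (hφ : IsTest φ) (s : ℝ) (l : ℂ) :
    Kf (applyQ Q fun y => φ (y - s) - l * φ y) (applyQ Q fun y => φ (y - s) - l * φ y) =
      Kf (fun x => applyQ Q φ (x - s)) (fun x => applyQ Q φ (x - s))
        - (starRingEnd ℂ) l * Kf (fun x => applyQ Q φ (x - s)) (applyQ Q φ)
        - l * Kf (applyQ Q φ) (fun x => applyQ Q φ (x - s))
        + l * (starRingEnd ℂ) l * Kf (applyQ Q φ) (applyQ Q φ) := by
  have hA : Continuous (applyQ Q φ) := continuous_applyQ Q hφ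
  have hAs : HasCompactSupport (applyQ Q φ) := hasCompactSupport_applyQ Q hφ
  have hτ : Continuous fun x => applyQ Q φ (x - s) := hA.comp (continuous_id.sub continuous_const)
  have hτs : HasCompactSupport fun x => applyQ Q φ (x - s) := hasCompactSupport_applyQ_transl Q hφ s
  have hψ : ∀ x, applyQ Q (fun y => φ (y - s) - l * φ y) x = applyQ Q φ (x - s) - l * applyQ Q φ x :=
    applyQ_transl_sub Q hφ s l
  unfold Kf
  -- pointwise expansion of the integrand
  have hpt : ∀ x, (fun y => fC (x - y) * applyQ Q (fun y => φ (y - s) - l * φ y) x *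
      (starRingEnd ℂ) (applyQ Q (fun y => φ (y - s) - l * φ y) y)) = fun y =>
      fC (x - y) * applyQ Q φ (x - s) * (starRingEnd ℂ) (applyQ Q φ (y - s))
        - (starRingEnd ℂ) l * (fC (x - y) * applyQ Q φ (x - s) * (starRingEnd ℂ) (applyQ Q φ y))
        - l * (fC (x - y) * applyQ Q φ x * (starRingEnd ℂ) (applyQ Q φ (y - s)))
        + l * (starRingEnd ℂ) l * (fC (x - y) * applyQ Q φ x * (starRingEnd ℂ) (applyQ Q φ y)) := by
    intro x; funext y; rw [hψ x, hψ y, map_sub, map_mul]; ring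
  have hin : (fun x => ∫ y, fC (x - y) * applyQ Q (fun y => φ (y - s) - l * φ y) x *
      (starRingEnd ℂ) (applyQ Q (fun y => φ (y - s) - l * φ y) y)) = fun x =>
      (∫ y, fC (x - y) * applyQ Q φ (x - s) * (starRingEnd ℂ) (applyQ Q φ (y - s)))
        - (starRingEnd ℂ) l * (∫ y, fC (x - y) * applyQ Q φ (x - s) * (starRingEnd ℂ) (applyQ Q φ y))
        - l * (∫ y, fC (x - y) * applyQ Q φ x * (starRingEnd ℂ) (applyQ Q φ (y - s)))
        + l * (starRingEnd ℂ) l * (∫ y, fC (x - y) * applyQ Q φ x * (starRingEnd ℂ) (applyQ Q φ y)) := by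
    funext x
    rw [hpt x]
    exact integral_expand4 (integrable_inner (u := fun x => applyQ Q φ (x - s)) hτ hτs x)
      (integrable_inner (u := fun x => applyQ Q φ (x - s)) hA hAs x)
      (integrable_inner (u := applyQ Q φ) hτ hτs x) (integrable_inner (u := applyQ Q φ) hA hAs x) l
  rw [hin]
  exact integral_expand4 (integrable_outer hτ hτs hτ hτs) (integrable_outer hτ hτs hA hAs)
    (integrable_outer hA hAs hτ hτs) (integrable_outer hA hAs hA hAs) l

/-- Translation invariance: `Kf (τ_s A) (τ_s A) = Kf A A`. -/
theorem Kf_transl_transl (A : ℝ → ℂ) (s : ℝ) :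
    Kf (fun x => A (x - s)) (fun x => A (x - s)) = Kf A A := by
  unfold Kf
  have h1 : ∀ x, (∫ y, fC (x - y) * A (x - s) * (starRingEnd ℂ) (A (y - s))) =
      (fun t => ∫ y, fC (t - y) * A t * (starRingEnd ℂ) (A y)) (x - s) := by
    intro x
    simp only
    rw [← integral_sub_right_eq_self (fun y => fC (x - s - y) * A (x - s) * (starRingEnd ℂ) (A y)) s]
    congr 1; funext y; rw [show x - s - (y - s) = x - y by ring]
  rw [show (fun x => ∫ y, fC (x - y) * A (x - s) * (starRingEnd ℂ) (A (y - s))) = _ from funext h1]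
  exact integral_sub_right_eq_self (fun t => ∫ y, fC (t - y) * A t * (starRingEnd ℂ) (A y)) s

/-- `Kf (τ_s A) A = transl Q φ s` for `A = Qφ`. -/
theorem Kf_transl_left (Q : Polynomial ℂ) (φ : ℝ → ℂ) (s : ℝ) :
    Kf (fun x => applyQ Q φ (x - s)) (applyQ Q φ) = transl Q φ s := by
  unfold Kf transl
  have h1 : ∀ x, (∫ y, fC (x - y) * applyQ Q φ (x - s) * (starRingEnd ℂ) (applyQ Q φ y)) =
      (fun t => ∫ y, fC (t + s - y) * applyQ Q φ t * (starRingEnd ℂ) (applyQ Q φ y)) (x - s) := by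
    intro x; simp only; congr 1; funext y; rw [show x - s + s - y = x - y by ring]
  rw [show (fun x => ∫ y, fC (x - y) * applyQ Q φ (x - s) * (starRingEnd ℂ) (applyQ Q φ y)) = _
    from funext h1]
  exact integral_sub_right_eq_self
    (fun t => ∫ y, fC (t + s - y) * applyQ Q φ t * (starRingEnd ℂ) (applyQ Q φ y)) s

/-- Joint compact support of `(x, t) ↦ g(x,t) · A x · B t`-type kernels. -/
theorem integrable_prod_kernel {A : ℝ → ℂ} (hA : Continuous A) (hAs : HasCompactSupport A) (s : ℝ) :
    Integrable (Function.uncurry fun x t : ℝ => fC (x - s - t) * A x * (starRingEnd ℂ) (A t))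
      (volume.prod volume) := by
  refine Continuous.integrable_of_hasCompactSupport ?_ ?_
  · exact ((continuous_fC.comp ((continuous_fst.sub continuous_const).sub continuous_snd)).mul
      (hA.comp continuous_fst)).mul (Complex.continuous_conj.comp (hA.comp continuous_snd))
  · refine HasCompactSupport.intro (hAs.prod hAs) fun p hp => ?_
    rw [Set.mem_prod, not_and_or] at hp
    rcases hp with h | h
    · simp [Function.uncurry, image_eq_zero_of_notMem_tsupport h]
    · simp [Function.uncurry, image_eq_zero_of_notMem_tsupport h]

/-- Hermitian symmetry + translation: `Kf A (τ_s A) = conj (transl Q φ s)` (uses Fubini, `fC` real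
and even). -/
theorem Kf_transl_right (Q : Polynomial ℂ) {φ : ℝ → ℂ} (hφ : IsTest φ) (s : ℝ) :
    Kf (applyQ Q φ) (fun x => applyQ Q φ (x - s)) = (starRingEnd ℂ) (transl Q φ s) := by
  have hA : Continuous (applyQ Q φ) := continuous_applyQ Q hφ
  have hAs : HasCompactSupport (applyQ Q φ) := hasCompactSupport_applyQ Q hφ
  unfold Kf transl
  have h1 : ∀ x, (∫ y, fC (x - y) * applyQ Q φ x * (starRingEnd ℂ) (applyQ Q φ (y - s))) =
      ∫ t, fC (x - s - t) * applyQ Q φ x * (starRingEnd ℂ) (applyQ Q φ t) := by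
    intro x
    rw [← integral_sub_right_eq_self
      (fun t => fC (x - s - t) * applyQ Q φ x * (starRingEnd ℂ) (applyQ Q φ t)) s]
    congr 1; funext y; rw [show x - s - (y - s) = x - y by ring]
  rw [show (fun x => ∫ y, fC (x - y) * applyQ Q φ x * (starRingEnd ℂ) (applyQ Q φ (y - s))) = _
    from funext h1]
  rw [← integral_conj]
  simp_rw [← integral_conj, map_mul, conj_fC, Complex.conj_conj]
  rw [integral_integral_swap (integrable_prod_kernel hA hAs s)]
  congr 1; funext t; congr 1; funext x
  rw [show x - s - t = -(t + s - x) by ring, fC_neg]; ring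

/-- **The positivity bound** `‖F_φ(s)‖ ≤ F_φ(0)`. -/
theorem norm_transl_le (Q : Polynomial ℂ) {φ : ℝ → ℂ} (hQ : KreinPos Q) (hφ : IsTest φ) (s : ℝ) :
    ‖transl Q φ s‖ ≤ (Kf (applyQ Q φ) (applyQ Q φ)).re := by
  have h0 : 0 ≤ (Kf (applyQ Q φ) (applyQ Q φ)).re := hQ φ hφ.1 hφ.2
  by_cases hT : transl Q φ s = 0
  · rw [hT, norm_zero]; exact h0
  · set T := transl Q φ s with hTdef
    have hTn : (‖T‖ : ℂ) ≠ 0 := by exact_mod_cast norm_ne_zero_iff.mpr hT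
    set l : ℂ := T / (‖T‖ : ℂ) with hl
    have hl1 : l * (starRingEnd ℂ) l = 1 := by
      rw [hl, map_div₀, Complex.conj_ofReal, div_mul_div_comm, Complex.mul_conj', ← pow_two,
        div_self (pow_ne_zero 2 hTn)]
    have hlT : (starRingEnd ℂ) l * T = (‖T‖ : ℂ) := by
      rw [hl, map_div₀, Complex.conj_ofReal, div_mul_eq_mul_div, Complex.conj_mul', pow_two,
        mul_div_assoc, div_self hTn, mul_one]
    have hψ := isTest_transl_sub hφ s l
    have hpos : 0 ≤ (Kf (applyQ Q fun y => φ (y - s) - l * φ y)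
        (applyQ Q fun y => φ (y - s) - l * φ y)).re := hQ _ hψ.1 hψ.2
    rw [Kf_transl_sub Q hφ s l, Kf_transl_transl, Kf_transl_left, Kf_transl_right Q hφ, hl1,
      ← hTdef, show l * (starRingEnd ℂ) T = (starRingEnd ℂ) ((starRingEnd ℂ) l * T) by simp,
      hlT, Complex.conj_ofReal] at hpos
    simp only [one_mul, sub_re, add_re, ofReal_re] at hpos
    linarith

/-- **Continuity of `F_φ`.** -/
theorem continuous_transl (Q : Polynomial ℂ) {φ : ℝ → ℂ} (hφ : IsTest φ) :
    Continuous (transl Q φ) := by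
  have hA : Continuous (applyQ Q φ) := continuous_applyQ Q hφ
  have hAs : HasCompactSupport (applyQ Q φ) := hasCompactSupport_applyQ Q hφ
  have h : transl Q φ = fun s => ∫ x in tsupport (applyQ Q φ),
      applyQ Q φ x * Gconv (applyQ Q φ) (x + s) := by
    funext s
    rw [← Kf_transl_left Q φ s, Kf_eq,
      ← integral_add_right_eq_self (fun x => applyQ Q φ (x - s) * Gconv (applyQ Q φ) x) s]
    simp only [add_sub_cancel_right]
    rw [setIntegral_eq_integral_of_forall_compl_eq_zero]
    intro x hx; simp [image_eq_zero_of_notMem_tsupport hx]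
  rw [h]
  have hc : Continuous (Function.uncurry fun (s x : ℝ) =>
      applyQ Q φ x * Gconv (applyQ Q φ) (x + s)) :=
    (hA.comp continuous_snd).mul ((continuous_Gconv hA hAs).comp (continuous_snd.add continuous_fst))
  exact continuous_parametric_integral_of_continuous hc hAs.isCompact

/-- **(A) holds.** [folklore: positive-definite kernels are bounded by their value at 0] -/
theorem pieceA_holds : PieceA := fun Q φ hQ hφ =>
  ⟨continuous_transl Q hφ, (Kf (applyQ Q φ) (applyQ Q φ)).re, norm_transl_le Q hQ hφ⟩

end Summit.RiemannHypothesis.RiemannHypothesis.Theorems.Splittings.ScrewKreinCore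

end
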